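import Literature.NumberTheory.Automorphic.Liu2021.Thm418AsPrinted
import Mathlib.LinearAlgebra.Contraction
import Mathlib.LinearAlgebra.Dual.BaseChange
import Mathlib.LinearAlgebra.Dual.Lemmas
import Mathlib.RingTheory.Flat.Basic
import Mathlib.RingTheory.TensorProduct.Free
import Mathlib.Algebra.Colimit.Module
import HarnessLib

/-!
# [Liu 2021, proof of Thm. 4.18] the map (4.3) «`f ⊗ z ↦ z · f^*α`» is INJECTIVE — by linear algebra, from
# faithfulness of `f ↦ f^*` on rational `H¹` and «`H¹_B(A_μ; ℚ)` is a line over `M_μ`»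

Y. Liu, *Fourier–Jacobi cycles and arithmetic relative trace formula*, Camb. J. Math. **9** (2021) 1–147 = arXiv:2102.11518
[Liu2021]; TeX source `FJcycle.tex` (md5 `6db49a74122d2cb0f224fa1b39488a0c`; `l. NNNN` = its lines).

## What this file is (and for whom)

In the proof of [Liu2021, Thm. 4.18] (l. 2247–2266) one fixes `D_μ = (A_μ, i_μ, λ_μ, r_μ) ∈ 𝒜(μ)` and `τ' ∈ Φ_μ`, notes
(l. 2249) «It is clear that the maximal subspace of the complex vector space `H¹_{B,τ'}(A_μ, ℂ)` over which `M_μ` acts via the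
inclusion `M_μ ↪ ℂ` has dimension `1`. We choose a basis `α` of this subspace. Then we obtain a map `Ω(μ) → H¹_{B,τ'}(A_∞, ℂ)` by
pulling back `α`, which is `ℂ[𝔾(𝔸_F^∞)]`-linear. It canonically extends to a map (4.3) `Ω(μ) ⊗_{M_μ} ℂ → H¹_{B,τ'}(A_∞, ℂ)`»,
and then (l. 2252–2266) identifies (4.3), via the comparison theorem and Faltings' isogeny theorem [Fal83], with an isomorphism onto
`⊕_{ε,χ} ω(μ,ε,χ)`; in particular (4.3) is injective.

The tree's Δ2 bridge «Thm. 4.18 AS PRINTED ⟹ the combined reading r8» (`Liu2021/Thm418CombinedReading.lean`, pin-3; capstone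
`Liu2021/Thm418BlockLeRange.lean`, this lineage) carries (4.3) as a consumer map `J : ℂ ⊗[M_μ] Ω(μ) →ₗ[ℂ] H` with the two printed
properties `hJ` (equivariance) and `hJinj : Function.Injective J` as BINDERS; the as-printed record of the proof map (M2,
`Map43AsPrinted`, item6-p1 lineage) types «(4.3) is injective» as a FIELD.  THIS FILE proves that INJECTIVITY of (4.3) needs
neither the comparison theorem nor [Fal83]: it is linear algebra over the RATIONAL structure through which «pulling back `α`» is
defined.  Precisely (`Map43.injective_of_eigenPullback`, fields `K ⊆ M`, `A` an `M`-algebra that is a field; intended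
`K = ℚ`, `M = M_μ`, `A = ℂ` via `M_μ ⊆ ℂ`):

* `L` — an `M`-vector space with `Module.finrank M L = 1`, finite-dimensional over `K` ⟨intended `H¹_B(A_μ ⊗_{E,τ'} ℂ; ℚ)` with `M_μ`
  acting through `i_μ : M_μ → End_E(A_μ)_ℚ` (Def. 4.5, l. 1948 «`i_μ` … is a CM structure»; l. 650 «`A_μ` has dimension
  `[M_μ:ℚ]/2`», so the `ℚ`-space `H¹_B(A_μ; ℚ)` of dimension `2 dim A_μ = [M_μ:ℚ]` is a LINE over the field `M_μ`) — this is the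
  rational form of l. 2249's «has dimension `1`»⟩;
* `U` — a `K`-vector space ⟨intended `H¹_B(A_K ⊗_{E,τ'} ℂ; ℚ)`, or `H¹_B(A_∞; ℚ) := colim_K`, no finiteness needed⟩;
* `Ω` — an `M`-module ⟨`Ω(μ) = Hom_E(A_∞, A_μ)_ℚ` (Rem. 4.17), or `Hom_E(A_K, A_μ)_ℚ`, `M_μ` acting via `i_μ` (Def. 4.16, l. 2219)⟩;
* `P : Ω →+ (L →ₗ[K] U)` with `P (m • f) l = P f (m • l)` and `P` INJECTIVE ⟨`f ↦ f^*` on rational `H¹`; `M_μ`-semilinearity is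
  contravariance `(i_μ(m) ∘ f)^* = f^* ∘ i_μ(m)^*`; injectivity is FAITHFULNESS of `H¹_B(−; ℚ)` on `Hom(−,−) ⊗ ℚ` of abelian
  varieties — in the tree `AbelianVariety.hom_eq_of_complexBetti_map_one_eq` /
  `AbelianVariety.injective_bettiCohomologyInt_map_one` (`Literature/AlgebraicGeometry/HodgeTheory/`), [Mumford, AV, §19]⟩;
* `α : A ⊗[K] L`, `α ≠ 0`, with `(m • ·)_A α = m · α` for all `m ∈ M` ⟨«a basis `α` of the subspace of `H¹_{B,τ'}(A_μ, ℂ) = ℂ ⊗_ℚ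
  H¹_B(A_μ; ℚ)` over which `M_μ` acts via the inclusion», l. 2249⟩;
* `J : A ⊗[M] Ω →ₗ[A] A ⊗[K] U` with `J (z ⊗ f) = z • (P f)_A (α)` ⟨(4.3) «by pulling back `α`», l. 2250; the tree's factor order
  `ℂ ⊗[M_μ] Ω(μ)` of `Thm418AsPrinted`, READING R3⟩.

CONCLUSION: `J` is injective.  Variants: `Map43.injective_of_eigenPullback_comp` (the same `J` followed by an injective
`A`-linear `ι : A ⊗[K] U → H` into the consumer's `H`, e.g. the comparison `ℂ ⊗_ℚ H¹_B(−; ℚ) ≅ H¹_B(−; ℂ)` or the inclusion of a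
level), `Thm418Data.injective_map43_of_eigenPullback` (the specialisation `K = ℚ`, `M = M_μ = fieldOfValues E D.μ`, `A = ℂ`,
`Ω = D.Ω` of the as-printed datum — exactly the binder `hJinj` of `Thm418Data.resW_mem_span_of_fixed_of_thm418AsPrinted[_act]`
and of `Thm418Data.iSup_range_resW_mem_span_of_thm418AsPrinted_of_rank_le_one`), and `Map43.directLimit_map_injective` (a
level-wise injective compatible family is injective on `Module.DirectLimit` — for consumers whose `H` and `Ω(μ) ⊗ ℂ` are towers
over the levels `K`, `A_∞ = lim_K A_K`, l. 2072); `Map43.exists_linearEquiv_of_line` / `Map43.finiteDimensional_of_line` record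
that these carriers already force `[M:K] < ∞` (at `M = M_μ`: l. 1928 «`M_μ` … is a number field» is implied, not assumed).

PROOF (no trace form, no Galois theory, no dimension count on `U`): pick `ξ₀ ∈ L^∨ = Hom_K(L, K)`, `ξ₀ ≠ 0`; since `L` is a line
over the field `M`, `m ↦ ξ₀(m • ·)` is a `K`-linear bijection `M ≃ L^∨` (private `bijective_dualPair`), whence
`κ : M ⊗_K U ≃ Hom_K(L, U)`, `m ⊗ u ↦ (l ↦ ξ₀(m l) u)`, which is `M`-semilinear; so `Φ' := κ⁻¹ ∘ P : Ω → M ⊗_K U` is `M`-LINEAR and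
injective, and `id_A ⊗_M Φ' : A ⊗_M Ω → A ⊗_M (M ⊗_K U) ≅ A ⊗_K U` is injective because `A` is flat over the FIELD `M`
(`Module.Flat.lTensor_preserves_injective_linearMap`).  Finally `J = c • (id_A ⊗ Φ')` with `c := (ξ₀)_A(α) ∈ A`, and `c ≠ 0`:
by the eigen-property `(ξ₀ ∘ m)_A(α) = m · c`, so `c = 0` would make every functional of `L^∨ = {ξ₀ ∘ m}` kill `α`, forcing
`α = 0` (private `eq_zero_of_forall_dual_baseChange_eq_zero`).  The idea (flat core + rank-one bridge) was sketched by the cell's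
planner seat s2crux-idea-1 (`RouteJ-Sketch.lean`, L = M case); this file is an independent formalisation for a general line `L`.

Theorems only: no definition, no instance, no named fact; nothing is asserted about Liu's objects — `L`, `U`, `P`, `α` and their
three properties are the consumer's (at an honest instantiation: Betti `H¹` with `ℚ`-coefficients, faithfulness, `2 dim A_μ =
[M_μ:ℚ]`).  HC_CM is NOT proved; this file discharges no binder of the COR-CM chain by itself (it turns the `hJinj` binder /
the «(4.3) is injective» field into a consequence of two structural facts about rational `H¹`).
Seat prover-pub-hodgecm2-tr-prover-6-g4-0 (item-(vi) END-display lineage), 2026-08-21.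

## References
* [Liu2021] Thm. 4.18 (l. 2232–2245) and its proof, map (4.3) = `eq:cm_albanese` (l. 2247–2266, esp. l. 2249–2250); Def. 4.5
  (l. 1936–1964), Def. 4.16 / Rem. 4.17 (l. 2218–2228), l. 650 («`A_μ` has dimension `[M_μ:ℚ]/2`»), l. 2072 (`A_∞ := lim_K A_K`).
* [Fal83] G. Faltings, *Endlichkeitssätze für abelsche Varietäten über Zahlkörpern*, Invent. Math. 73 (1983) — used by Liu for
  the IMAGE of (4.3); NOT needed for injectivity.
* [Mumford, AV] D. Mumford, *Abelian varieties*, §19 (faithfulness of `H¹` / `T_ℓ` on `Hom ⊗ ℚ`).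
* Tree: `Liu2021.Thm418AsPrinted` (p277833), `Liu2021.Thm418CombinedReading` (pin-3), `Liu2021.Thm418BlockLeRange` (capstone).
-/

noncomputable section

open scoped TensorProduct
open TensorProduct Module NumberField

namespace Literature.NumberTheory.Automorphic.Liu2021

namespace Map43

universe uK uM uA uL uU uΩ

variable {K : Type uK} [Field K] {M : Type uM} [Field M] [Algebra K M]
variable {A : Type uA} [Field A] [Algebra K A] [Algebra M A] [IsScalarTower K M A]
variable {L : Type uL} [AddCommGroup L] [Module K L] [Module M L] [IsScalarTower K M L]
variable {U : Type uU} [AddCommGroup U] [Module K U]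
variable {Ω : Type uΩ} [AddCommGroup Ω] [Module M Ω]

/-! ## The pairing `m ↦ ξ₀(m • ·) : M → L^∨` through a non-zero functional `ξ₀` -/

/-- Unfolding: the `K`-linear map `m ↦ ξ₀ ∘ (m • ·)`, written with Mathlib's `LinearMap.llcomp` and `Algebra.lsmul`, sends `m`
to the functional `l ↦ ξ₀ (m • l)`.  Our bookkeeping (private helper). [folklore] -/
private theorem llcomp_lsmul_apply (ξ₀ : Dual K L) (m : M) (l : L) :
    (LinearMap.llcomp K L L K ξ₀ ∘ₗ (Algebra.lsmul K K L : M →ₐ[K] Module.End K L).toLinearMap) m l = ξ₀ (m • l) := rfl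

/-- For a non-zero functional `ξ₀ ∈ L^∨` on a vector space `L` over the field `M ⊇ K`, the pairing `m ↦ ξ₀(m • ·) : M → L^∨` is
injective: if `ξ₀ (m • l) = 0` for all `l` and `m ≠ 0`, then `ξ₀ = 0` (take `l := m⁻¹ • l'`). (Private helper.) [folklore] -/
private theorem injective_dualPair (ξ₀ : Dual K L) (hξ : ξ₀ ≠ 0) :
    Function.Injective (LinearMap.llcomp K L L K ξ₀ ∘ₗ (Algebra.lsmul K K L : M →ₐ[K] Module.End K L).toLinearMap) := by
  rw [injective_iff_map_eq_zero]
  intro m hm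
  by_contra hm0
  apply hξ
  ext l
  have h := LinearMap.congr_fun hm (m⁻¹ • l)
  rw [llcomp_lsmul_apply, smul_smul, mul_inv_cancel₀ hm0, one_smul] at h
  simpa using h

/-- **A line over `M` is `K`-linearly isomorphic to `M`.**  If `Module.finrank M L = 1`, then for a generator `l₀` the map
`m ↦ m • l₀` is a `K`-linear bijection `M ≃ L` (returned as `l₀` with the equivalence).  At the intended instantiation (`K = ℚ`,
`M = M_μ`, `L = H¹_B(A_μ; ℚ)`, l. 650 + Def. 4.5) this is the bookkeeping behind `finiteDimensional_of_line`: the carriers of the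
rational presentation of (4.3) already contain l. 1928 «`M_μ ⊆ ℂ` … which is a number field».
[cite: Liu2021, §4.1 l. 1928 («M_μ … is a number field») with Def. 4.5 (l. 1948) and l. 650] -/
theorem exists_linearEquiv_of_line (hL : Module.finrank M L = 1) :
    ∃ (l₀ : L) (e : M ≃ₗ[K] L), ∀ m : M, e m = m • l₀ := by
  obtain ⟨l₀, hl₀, hspan⟩ := finrank_eq_one_iff'.mp hL
  -- the `K`-linear bijection `M ≃ L`, `m ↦ m • l₀`
  let e₀ : M →ₗ[K] L :=
    { toFun := fun m => m • l₀
      map_add' := fun a b => add_smul a b l₀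
      map_smul' := fun k m => by rw [RingHom.id_apply, smul_assoc] }
  have he₀ : Function.Bijective e₀ := by
    refine ⟨fun a b h => ?_, fun w => by simpa [e₀] using hspan w⟩
    by_contra hab
    apply hl₀
    have h' : (a - b) • l₀ = 0 := by
      have h'' : a • l₀ = b • l₀ := by simpa [e₀] using h
      rw [sub_smul, h'', sub_self]
    calc l₀ = (a - b)⁻¹ • ((a - b) • l₀) := by
            rw [smul_smul, inv_mul_cancel₀ (sub_ne_zero.mpr hab), one_smul]
      _ = 0 := by rw [h', smul_zero]
  exact ⟨l₀, LinearEquiv.ofBijective e₀ he₀, fun m => rfl⟩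

/-- **`[M:K] < ∞` from the line.**  Under `Module.finrank M L = 1` and `Module.Finite K L`, `M` is finite-dimensional over `K`
(`exists_linearEquiv_of_line`).  Intended reading: the rational carriers of (4.3) imply l. 1928 «`M_μ` … is a number field»; no
separate binder is needed. [cite: Liu2021, §4.1 l. 1928 with Def. 4.5 (l. 1948) and l. 650] -/
theorem finiteDimensional_of_line [Module.Finite K L] (hL : Module.finrank M L = 1) : FiniteDimensional K M := by
  obtain ⟨-, e, -⟩ := exists_linearEquiv_of_line (K := K) hL
  exact LinearEquiv.finiteDimensional e.symm

/-- **`M ≃ L^∨` through any non-zero functional, for a LINE `L` over `M`.**  If `Module.finrank M L = 1` and `L` is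
finite-dimensional over `K`, then for every `ξ₀ ∈ L^∨ ∖ 0` the pairing `m ↦ ξ₀(m • ·) : M → L^∨ = Hom_K(L, K)` is a `K`-linear
bijection (injective by `injective_dualPair`; `dim_K M = dim_K L = dim_K L^∨` through `m ↦ m • l₀` for a generator `l₀`).  No trace
form and no separability are used. (Private helper.) [folklore] -/
private theorem bijective_dualPair [Module.Finite K L] (hL : Module.finrank M L = 1) (ξ₀ : Dual K L) (hξ : ξ₀ ≠ 0) :
    Function.Bijective (LinearMap.llcomp K L L K ξ₀ ∘ₗ (Algebra.lsmul K K L : M →ₐ[K] Module.End K L).toLinearMap) := by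
  obtain ⟨-, e, -⟩ := exists_linearEquiv_of_line (K := K) hL
  haveI : FiniteDimensional K M := LinearEquiv.finiteDimensional e.symm
  refine ⟨injective_dualPair ξ₀ hξ, ?_⟩
  exact (LinearMap.injective_iff_surjective_of_finrank_eq_finrank
    (e.finrank_eq.trans Subspace.dual_finrank_eq.symm)).1 (injective_dualPair ξ₀ hξ)

/-! ## Coordinates of `β ∈ A ⊗_K L` are values of base-changed functionals -/

/-- Along the base-changed basis `A ⊗ b` of `A ⊗_K L`, the `k`-th coordinate of `β` is the base change `(b^∨_k)_A (β) ∈ A` of the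
coordinate functional `b^∨_k = b.coord k ∈ L^∨`. Our bookkeeping (private helper). [folklore] -/
private theorem basis_repr_eq_dual_baseChange {ι : Type*} (b : Basis ι K L) (β : A ⊗[K] L) (k : ι) :
    (Algebra.TensorProduct.basis A b).repr β k = Dual.baseChange A (b.coord k) β := by
  induction β using TensorProduct.induction_on with
  | zero => simp
  | tmul a y =>
      rw [Algebra.TensorProduct.basis_repr_tmul, Dual.baseChange_apply_tmul]
      simp [Finsupp.smul_apply, Finsupp.mapRange_apply, Algebra.smul_def, mul_comm]
  | add b₁ b₂ h₁ h₂ => simp [map_add, h₁, h₂]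

/-- If every functional `ξ ∈ L^∨`, base-changed to `A ⊗_K L → A`, kills `β`, then `β = 0` (all coordinates of `β` along a
base-changed `K`-basis of `L` vanish). (Private helper.) [folklore] -/
private theorem eq_zero_of_forall_dual_baseChange_eq_zero (β : A ⊗[K] L) (h : ∀ ξ : Dual K L, Dual.baseChange A ξ β = 0) :
    β = 0 := by
  let b := Module.Free.chooseBasis K L
  have hrepr : (Algebra.TensorProduct.basis A b).repr β = 0 := by
    ext k
    rw [basis_repr_eq_dual_baseChange]
    exact h _
  simpa using hrepr

/-! ## The theorem: (4.3) is injective -/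

/-- **[Liu2021, proof of Thm. 4.18] — the map (4.3) «`f ⊗ z ↦ z · f^*α`» is injective, by linear algebra.**
Setting (module docstring): fields `K ⊆ M` and an `M`-algebra `A` that is a field (intended `ℚ ⊆ M_μ ⊆ ℂ`); `L` an `M`-LINE,
finite-dimensional over `K` ⟨`H¹_B(A_μ; ℚ)`, a line over `M_μ` by Def. 4.5 (`i_μ` a CM structure, l. 1948) and l. 650
(`dim A_μ = [M_μ:ℚ]/2`) — the rational form of l. 2249 «has dimension 1»⟩; `U` a `K`-space ⟨`H¹_B(A_K; ℚ)` or `H¹_B(A_∞; ℚ)`⟩; `Ω` an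
`M`-module ⟨`Ω(μ) = Hom_E(A_∞, A_μ)_ℚ`, `M_μ` via `i_μ`, Def. 4.16 / Rem. 4.17⟩; `P : Ω → Hom_K(L, U)` additive, `M`-semilinear
(`P (m • f) l = P f (m • l)` = contravariance of `f ↦ f^*`) and INJECTIVE ⟨faithfulness of rational `H¹` on `Hom ⊗ ℚ`, tree
`AbelianVariety.hom_eq_of_complexBetti_map_one_eq`⟩; `α ∈ A ⊗_K L` non-zero with `(m • ·)_A α = m · α` ⟨Liu's basis `α` of the
eigenline, l. 2249⟩; `J (z ⊗ f) = z • (P f)_A(α)` ⟨(4.3) «by pulling back `α`», l. 2250⟩.  CONCLUSION: `J` is injective.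
PROOF: module docstring (`M ≃ L^∨` through `ξ₀ ≠ 0`; `κ : M ⊗_K U ≃ Hom_K(L, U)`; `Φ' := κ⁻¹ ∘ P` is `M`-linear injective;
flatness of `A` over the field `M`; `J = c • (id_A ⊗ Φ')` with `c = (ξ₀)_A(α) ≠ 0`).  The printed proof obtains injectivity
(together with the image) from the comparison theorem and [Fal83]; neither is used here.  HC_CM is NOT proved.
[cite: Liu2021, proof of Thm. 4.18, map (4.3) (FJcycle.tex l. 2247–2266, esp. l. 2249–2250); Def. 4.5 (l. 1948); l. 650] -/
theorem injective_of_eigenPullback [Module.Finite K L] (hL : Module.finrank M L = 1)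
    (P : Ω →+ (L →ₗ[K] U)) (hPM : ∀ (m : M) (f : Ω) (l : L), P (m • f) l = P f (m • l))
    (hP : Function.Injective P)
    (α : A ⊗[K] L) (hα0 : α ≠ 0)
    (hα : ∀ m : M, (DistribSMul.toLinearMap K L m).baseChange A α = algebraMap M A m • α)
    (J : A ⊗[M] Ω →ₗ[A] A ⊗[K] U)
    (hJ : ∀ (z : A) (f : Ω), J (z ⊗ₜ[M] f) = z • (P f).baseChange A α) :
    Function.Injective J := by
  classical
  -- the semilinearity of `P` as an identity of `K`-linear maps
  have hPM' : ∀ (m : M) (f : Ω), P (m • f) = P f ∘ₗ DistribSMul.toLinearMap K L m := fun m f =>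
    LinearMap.ext fun l => by rw [LinearMap.comp_apply, DistribSMul.toLinearMap_apply, hPM]
  -- Step 0: `L ≠ 0`, a non-zero functional `ξ₀ ∈ L^∨`, and the bijection `m ↦ ξ₀(m • ·) : M ≃ L^∨`
  obtain ⟨l₀, hl₀, -⟩ := finrank_eq_one_iff'.mp hL
  obtain ⟨ξ₀, hξ⟩ : ∃ ξ₀ : Dual K L, ξ₀ ≠ 0 := by
    obtain ⟨ξ, hξ⟩ := Projective.exists_dual_ne_zero K hl₀
    exact ⟨ξ, fun h => hξ (by rw [h, LinearMap.zero_apply])⟩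
  have hbij := bijective_dualPair hL ξ₀ hξ
  set π : M →ₗ[K] Dual K L :=
    LinearMap.llcomp K L L K ξ₀ ∘ₗ (Algebra.lsmul K K L : M →ₐ[K] Module.End K L).toLinearMap with hπ_def
  have hπ : ∀ (m : M) (l : L), π m l = ξ₀ (m • l) := fun _ _ => rfl
  -- every functional is `ξ₀(m • ·)` for a unique `m`
  have hsurj : ∀ ξ : Dual K L, ∃ m : M, ∀ l, ξ l = ξ₀ (m • l) := by
    intro ξ
    obtain ⟨m, hm⟩ := hbij.2 ξ
    exact ⟨m, fun l => by rw [← hm, hπ]⟩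
  -- Step 1: `κ : M ⊗_K U ≃ Hom_K(L, U)`, `m ⊗ u ↦ (l ↦ ξ₀ (m • l) • u)`
  obtain ⟨κ, hκ⟩ : ∃ κ : M ⊗[K] U ≃ₗ[K] (L →ₗ[K] U), ∀ (m : M) (u : U) (l : L), κ (m ⊗ₜ[K] u) l = ξ₀ (m • l) • u := by
    refine ⟨(LinearEquiv.ofBijective π hbij).rTensor U ≪≫ₗ dualTensorHomEquiv K L U, fun m u l => ?_⟩
    simp [LinearEquiv.rTensor_tmul, dualTensorHomEquiv, hπ]
  -- `κ` is `M`-semilinear for the left action on `M ⊗_K U` and the domain action on `Hom_K(L, U)`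
  have hκ_smul : ∀ (m : M) (t : M ⊗[K] U), κ (m • t) = κ t ∘ₗ DistribSMul.toLinearMap K L m := by
    intro m t
    induction t using TensorProduct.induction_on with
    | zero => simp
    | tmul m₁ u =>
        ext l
        rw [TensorProduct.smul_tmul', hκ, LinearMap.comp_apply, DistribSMul.toLinearMap_apply, hκ, smul_eq_mul, mul_smul,
          smul_comm m m₁ l]
    | add t₁ t₂ h₁ h₂ => simp [smul_add, h₁, h₂, LinearMap.add_comp]
  -- Step 2: `Φ' := κ⁻¹ ∘ P : Ω → M ⊗_K U` is `M`-linear and injective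
  let Φ' : Ω →ₗ[M] M ⊗[K] U :=
    { toFun := fun f => κ.symm (P f)
      map_add' := fun f g => by simp
      map_smul' := fun m f => by
        apply κ.injective
        rw [LinearEquiv.apply_symm_apply, RingHom.id_apply, hκ_smul, LinearEquiv.apply_symm_apply, hPM'] }
  have hΦ'κ : ∀ f, κ (Φ' f) = P f := fun f => LinearEquiv.apply_symm_apply _ _
  have hΦ'inj : Function.Injective Φ' := fun f g hfg =>
    hP (by rw [← hΦ'κ f, ← hΦ'κ g]; exact congrArg κ hfg)
  -- Step 3: the scalar `c := (ξ₀)_A(α)` and the eigen-relation `(ξ₀ ∘ m)_A(α) = m · c`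
  set c : A := Dual.baseChange A ξ₀ α with hc_def
  have hev : ∀ m : M,
      Dual.baseChange A ξ₀ ((DistribSMul.toLinearMap K L m).baseChange A α) = algebraMap M A m * c := by
    intro m
    rw [hα m, map_smul, smul_eq_mul]
  have hev_pair : ∀ (ξ : Dual K L) (m : M), (∀ l, ξ l = ξ₀ (m • l)) →
      ∀ β : A ⊗[K] L, Dual.baseChange A ξ β = Dual.baseChange A ξ₀ ((DistribSMul.toLinearMap K L m).baseChange A β) := by
    intro ξ m hξm β
    induction β using TensorProduct.induction_on with
    | zero => simp
    | tmul a y => rw [LinearMap.baseChange_tmul, DistribSMul.toLinearMap_apply, Dual.baseChange_apply_tmul,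
        Dual.baseChange_apply_tmul, hξm]
    | add b₁ b₂ h₁ h₂ => simp only [map_add, h₁, h₂]
  -- `c ≠ 0`: otherwise every functional kills `α`, so `α = 0`
  have hc : c ≠ 0 := by
    intro hc0
    apply hα0
    refine eq_zero_of_forall_dual_baseChange_eq_zero α fun ξ => ?_
    obtain ⟨m, hm⟩ := hsurj ξ
    rw [hev_pair ξ m hm, hev, hc0, mul_zero]
  -- Step 4: `J = c • (cancel ∘ (id_A ⊗ Φ'))`, checked on `z ⊗ f` and then on pure tensors `m ⊗ u` of `M ⊗_K U`
  have hκ_bc : ∀ (m : M) (u : U) (β : A ⊗[K] L),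
      (κ (m ⊗ₜ[K] u)).baseChange A β = (Dual.baseChange A ξ₀ ((DistribSMul.toLinearMap K L m).baseChange A β)) ⊗ₜ[K] u := by
    intro m u β
    induction β using TensorProduct.induction_on with
    | zero => simp
    | tmul a y =>
        rw [LinearMap.baseChange_tmul, hκ, LinearMap.baseChange_tmul, DistribSMul.toLinearMap_apply, Dual.baseChange_apply_tmul,
          TensorProduct.tmul_smul, TensorProduct.smul_tmul']
    | add b₁ b₂ h₁ h₂ => simp only [map_add, h₁, h₂, TensorProduct.add_tmul]
  have key : ∀ (z : A) (t : M ⊗[K] U),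
      z • (κ t).baseChange A α = c • (AlgebraTensorModule.cancelBaseChange K M A A U) (z ⊗ₜ[M] t) := by
    intro z t
    induction t using TensorProduct.induction_on with
    | zero => simp
    | tmul m u =>
        rw [hκ_bc, hev, AlgebraTensorModule.cancelBaseChange_tmul, TensorProduct.smul_tmul', TensorProduct.smul_tmul',
          smul_eq_mul, smul_eq_mul, Algebra.smul_def m z]
        congr 1
        ring
    | add t₁ t₂ h₁ h₂ =>
        simp only [map_add, LinearMap.baseChange_add, LinearMap.add_apply, smul_add, TensorProduct.tmul_add, h₁, h₂]
  have hJ' : J = c • ((AlgebraTensorModule.cancelBaseChange K M A A U).toLinearMap ∘ₗ Φ'.baseChange A) := by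
    refine LinearMap.ext fun v => ?_
    induction v using TensorProduct.induction_on with
    | zero => simp
    | tmul z f =>
        rw [hJ, LinearMap.smul_apply, LinearMap.comp_apply, LinearMap.baseChange_tmul, LinearEquiv.coe_coe, ← hΦ'κ f]
        exact key z (Φ' f)
    | add x₁ x₂ h₁ h₂ => simp only [map_add, h₁, h₂]
  -- Step 5: conclude by flatness of `A` over the field `M`
  have hflat : Function.Injective
      ((AlgebraTensorModule.cancelBaseChange K M A A U).toLinearMap ∘ₗ Φ'.baseChange A) := by
    rw [LinearMap.coe_comp]
    exact (LinearEquiv.injective _).comp (Module.Flat.lTensor_preserves_injective_linearMap (M := A) Φ' hΦ'inj)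
  rw [hJ']
  intro x y hxy
  apply hflat
  have h := congrArg (fun v => c⁻¹ • v) hxy
  simpa [LinearMap.smul_apply, smul_smul, inv_mul_cancel₀ hc] using h

/-- **(4.3) followed by an injective comparison is injective.**  Same data as `injective_of_eigenPullback`, but the consumer's
map `J' : A ⊗[M] Ω →ₗ[A] H` lands in an arbitrary `A`-module `H` through an injective `A`-linear `ι : A ⊗[K] U → H`,
`J' (z ⊗ f) = ι (z • (P f)_A(α))` ⟨`ι` = the comparison `ℂ ⊗_ℚ H¹_B(−; ℚ) ≅ H¹_B(−; ℂ)`, or the inclusion of a level of the tower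
`H¹_{B,τ'}(A_∞, ℂ) = colim_K H¹_{B,τ'}(A_K, ℂ)`⟩.  Then `J'` is injective.  HC_CM is NOT proved.
[cite: Liu2021, proof of Thm. 4.18, map (4.3) (FJcycle.tex l. 2247–2266)] -/
theorem injective_of_eigenPullback_comp [Module.Finite K L] (hL : Module.finrank M L = 1)
    (P : Ω →+ (L →ₗ[K] U)) (hPM : ∀ (m : M) (f : Ω) (l : L), P (m • f) l = P f (m • l))
    (hP : Function.Injective P)
    (α : A ⊗[K] L) (hα0 : α ≠ 0)
    (hα : ∀ m : M, (DistribSMul.toLinearMap K L m).baseChange A α = algebraMap M A m • α)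
    {H : Type*} [AddCommGroup H] [Module A H] (ι : A ⊗[K] U →ₗ[A] H) (hι : Function.Injective ι)
    (J' : A ⊗[M] Ω →ₗ[A] H)
    (hJ' : ∀ (z : A) (f : Ω), J' (z ⊗ₜ[M] f) = ι (z • (P f).baseChange A α)) :
    Function.Injective J' := by
  -- the `M`-linear «pull back `α`» map `pb : Ω → A ⊗_K U` and `J := pb.liftBaseChange A`
  let pb : Ω →ₗ[M] A ⊗[K] U :=
    { toFun := fun f => (P f).baseChange A α
      map_add' := fun f g => by simp
      map_smul' := fun m f => by
        have hPM' : P (m • f) = P f ∘ₗ DistribSMul.toLinearMap K L m :=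
          LinearMap.ext fun l => by rw [LinearMap.comp_apply, DistribSMul.toLinearMap_apply, hPM]
        rw [RingHom.id_apply, hPM', LinearMap.baseChange_comp, LinearMap.comp_apply, hα m, map_smul,
          algebraMap_smul] }
  have hpb : ∀ f, pb f = (P f).baseChange A α := fun _ => rfl
  let J : A ⊗[M] Ω →ₗ[A] A ⊗[K] U := pb.liftBaseChange A
  have hJ : ∀ (z : A) (f : Ω), J (z ⊗ₜ[M] f) = z • (P f).baseChange A α := fun z f => by
    rw [LinearMap.liftBaseChange_tmul, hpb]
  have hJJ' : J' = ι ∘ₗ J := by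
    refine LinearMap.ext fun v => ?_
    induction v using TensorProduct.induction_on with
    | zero => simp
    | tmul z f => rw [hJ', LinearMap.comp_apply, hJ]
    | add x₁ x₂ h₁ h₂ => simp only [map_add, h₁, h₂]
  rw [hJJ', LinearMap.coe_comp]
  exact hι.comp (injective_of_eigenPullback hL P hPM hP α hα0 hα J hJ)

/-! ## Passing to the tower: a level-wise injective compatible family is injective on the direct limit -/

/-- **Injectivity on `colim`.**  If every `g i : G i → G' i` is injective and the `g i` commute with the transition maps, then
`Module.DirectLimit.map g` is injective (Mathlib has `Module.DirectLimit.lift_injective` for a fixed target; this is the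
functorial version, through `Module.DirectLimit.exists_eq_of_of_eq`).  For consumers of (4.3) on the tower: `G i := ℂ ⊗_{M_μ}
Hom_E(A_{K_i}, A_μ)_ℚ`, `G' i := H¹_{B,τ'}(A_{K_i}, ℂ)`, `g i :=` (4.3) at level `K_i` (injective by `injective_of_eigenPullback`),
`A_∞ = lim_K A_K` (l. 2072) so `Ω(μ) = colim_K Hom_E(A_K, A_μ)_ℚ` and `H¹_{B,τ'}(A_∞, ℂ) = colim_K`.  HC_CM is NOT proved.
[cite: Liu2021, §4.2 l. 2070–2074 (the projective system `{A_K}_K`, `A_∞`)] -/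
theorem directLimit_map_injective {R : Type*} [Semiring R] {ι : Type*} [Preorder ι] [DecidableEq ι]
    [IsDirectedOrder ι] {G : ι → Type*} [∀ i, AddCommMonoid (G i)] [∀ i, Module R (G i)]
    {f : ∀ i j, i ≤ j → G i →ₗ[R] G j} [DirectedSystem G (f · · ·)]
    {G' : ι → Type*} [∀ i, AddCommMonoid (G' i)] [∀ i, Module R (G' i)]
    {f' : ∀ i j, i ≤ j → G' i →ₗ[R] G' j} [DirectedSystem G' (f' · · ·)]
    (g : ∀ i, G i →ₗ[R] G' i) (hg : ∀ i j h, g j ∘ₗ f i j h = f' i j h ∘ₗ g i)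
    (hinj : ∀ i, Function.Injective (g i)) :
    Function.Injective (Module.DirectLimit.map g hg : Module.DirectLimit G f →ₗ[R] Module.DirectLimit G' f') := by
  cases isEmpty_or_nonempty ι
  · exact Function.injective_of_subsingleton _
  intro z w hzw
  obtain ⟨i, x, y, rfl, rfl⟩ := Module.DirectLimit.exists_of₂ z w
  rw [Module.DirectLimit.map_apply_of, Module.DirectLimit.map_apply_of] at hzw
  obtain ⟨j, hij, hj⟩ := Module.DirectLimit.exists_eq_of_of_eq hzw
  have hx := LinearMap.congr_fun (hg i j hij) x
  have hy := LinearMap.congr_fun (hg i j hij) y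
  simp only [LinearMap.coe_comp, Function.comp_apply] at hx hy
  rw [← hx, ← hy] at hj
  have hxy : f i j hij x = f i j hij y := hinj j hj
  calc Module.DirectLimit.of R ι G f i x
      = Module.DirectLimit.of R ι G f j (f i j hij x) := Module.DirectLimit.of_f.symm
    _ = Module.DirectLimit.of R ι G f j (f i j hij y) := by rw [hxy]
    _ = Module.DirectLimit.of R ι G f i y := Module.DirectLimit.of_f

end Map43

/-! ## The specialisation to the as-printed datum of Thm. 4.18 (`K = ℚ`, `M = M_μ`, `A = ℂ`, `Ω = Ω(μ)`) -/

namespace Thm418Data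

variable {F E : Type} [Field F] [NumberField F] [IsTotallyReal F] [Field E] [NumberField E] [Algebra F E]
  [IsTotallyComplex E] [Algebra.IsQuadraticExtension F E] {D : Thm418Data F E}

/-- **The `hJinj` binder of the Δ2 bridge is a theorem over rational `H¹`.**  For the as-printed datum `D` of [Liu2021, Thm. 4.18]
(`Ω(μ) = D.Ω`, `M_μ = fieldOfValues E D.μ ⊆ ℂ`), let the consumer present the proof map (4.3) `J : ℂ ⊗[M_μ] Ω(μ) →ₗ[ℂ] H` — the
carrier of `Thm418Data.resW_mem_span_of_fixed_of_thm418AsPrinted[_act]` / `…block_resW_mem_span_of_thm418AsPrinted[_act]`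
(`Thm418CombinedReading.lean`) and of `Thm418Data.iSup_range_resW_mem_span_of_thm418AsPrinted_of_rank_le_one`
(`Thm418BlockLeRange.lean`) — HONESTLY, i.e. as «`z ⊗ f ↦ ι (z • f^*α)`» (l. 2250) through: a `ℚ`-form `L` of `H¹_{B,τ'}(A_μ, ℂ)`
that is an `M_μ`-line ⟨`H¹_B(A_μ; ℚ)`; Def. 4.5 + l. 650⟩, a `ℚ`-space `U` with an injective `ℂ`-linear `ι : ℂ ⊗_ℚ U → H`
⟨`H¹_B(A_∞; ℚ)` or a level, with the comparison⟩, the rational pull-back `P : Ω(μ) → Hom_ℚ(L, U)`, `f ↦ f^*`, `M_μ`-semilinear and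
injective ⟨faithfulness⟩, and Liu's `α ∈ ℂ ⊗_ℚ L`, `α ≠ 0`, on which `M_μ` acts through the inclusion (l. 2249).  Then
`hJinj : Function.Injective J` HOLDS.  HC_CM is NOT proved; `L`, `U`, `P`, `α`, `ι` are the consumer's honest carriers.
[cite: Liu2021, proof of Thm. 4.18, map (4.3) (FJcycle.tex l. 2247–2266, esp. l. 2249–2250); Def. 4.5; l. 650] -/
theorem injective_map43_of_eigenPullback
    {L : Type*} [AddCommGroup L] [Module ℚ L] [Module (fieldOfValues E D.μ) L] [IsScalarTower ℚ (fieldOfValues E D.μ) L]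
    [Module.Finite ℚ L] (hL : Module.finrank (fieldOfValues E D.μ) L = 1)
    {U : Type*} [AddCommGroup U] [Module ℚ U]
    (P : D.Ω →+ (L →ₗ[ℚ] U))
    (hPM : ∀ (m : fieldOfValues E D.μ) (f : D.Ω) (l : L), P (m • f) l = P f (m • l))
    (hP : Function.Injective P)
    (α : ℂ ⊗[ℚ] L) (hα0 : α ≠ 0)
    (hα : ∀ m : fieldOfValues E D.μ,
      (DistribSMul.toLinearMap ℚ L m).baseChange ℂ α = algebraMap (fieldOfValues E D.μ) ℂ m • α)
    {H : Type*} [AddCommGroup H] [Module ℂ H] (ι : ℂ ⊗[ℚ] U →ₗ[ℂ] H) (hι : Function.Injective ι)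
    (J : ℂ ⊗[fieldOfValues E D.μ] D.Ω →ₗ[ℂ] H)
    (hJ : ∀ (z : ℂ) (f : D.Ω), J (z ⊗ₜ[fieldOfValues E D.μ] f) = ι (z • (P f).baseChange ℂ α)) :
    Function.Injective J :=
  Map43.injective_of_eigenPullback_comp hL P hPM hP α hα0 hα ι hι J hJ

end Thm418Data

end Literature.NumberTheory.Automorphic.Liu2021

end
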